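import Summits.CriticalPhenomena.PercolationContinuityZ3.Theorems.PercNearOneGluingNoHeavyPcintNawFreeMemKernel
import HarnessLib

/-!
# PCINT lane, reduction B2d on the dangerous-set automaton — kernel mirrors: the pseudo-tip, the corner and the inspected sites

Cell `prim-pcint` (PAPER-2 track (iii)), seat `prim-pcint-1` (gen 6); support file (`--supports stmt-CriticalPhenomena-4575`).
Does NOT build on p205010.  Memo: run/shared/lean/prim/pcint/REDUCTIONS.md §B2d.

Bridges for `posAtK` (the known entry of a given age), `fcornerK`/`fcondK` and `fsitesK` (`fcornerK_eq`, `fcondK_eq`,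
`fsites_eq_toFinset`: the kernel list of inspected sites denotes `fsites` without repetition), for well-formed lists with valid ages.
-/

namespace Summit.CriticalPhenomena.PercolationContinuityZ3.Theorems.Pcint

open Finset Literature.Probability.Percolation Literature.Probability.LatticeModels

namespace NawK

open WinK (toSite toL addL adjL toSite_addL toSite_toL adj_iff_adjL toSite_inj length_toL length_addL toSite_zeroL zeroL
  length_zeroL)

variable {d : ℕ}

section SiteBridges

variable {L : KState} {a : Fin d × Bool}

/-- `posAtK` finds the (unique) known entry of a given age. [folklore] -/
theorem posAtK_eq_some_iff (hA : AOK L = true) {A : ℕ} {x : List ℤ} :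
    posAtK (fKK d L a) A = some x ↔ (x, A) ∈ fKK d L a := by
  rw [posAtK]
  constructor
  · intro h
    cases hf : (fKK d L a).find? (fun q => q.2 == A) with
    | none => rw [hf] at h; exact absurd h (by simp)
    | some y =>
      rw [hf, Option.map_some] at h
      have hy := List.find?_some hf
      have hmem := List.mem_of_find?_eq_some hf
      simp only [beq_iff_eq] at hy
      have hx : y.1 = x := Option.some.inj h
      rw [← hx, ← hy]; exact hmem
  · intro h
    cases hf : (fKK d L a).find? (fun q => q.2 == A) with
    | none =>
      have := List.find?_eq_none.1 hf (x, A) h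
      simp at this
    | some y =>
      rw [Option.map_some]
      have hy := List.find?_some hf
      have hmem := List.mem_of_find?_eq_some hf
      simp only [beq_iff_eq] at hy
      have : y = (x, A) := List.inj_on_of_nodup_map (nodup_ages_fKK hA a) hmem h (by simp [hy])
      rw [this]

/-- Known entries of age `A`, semantically. [folklore] -/
theorem mem_fK_age_iff (hL : WF d L = true) {A : ℕ} {P : Site d} :
    (P, A) ∈ fK (toM L : MState d) a ↔ ∃ x, (x, A) ∈ fKK d L a ∧ toSite x = P := by
  rw [← toM_fKK hL, mem_toM]
  constructor
  · rintro ⟨y, hy, hye⟩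
    refine ⟨y.1, ?_, congrArg Prod.fst hye⟩
    have : y.2 = A := congrArg Prod.snd hye
    rw [← this]; exact hy
  · rintro ⟨x, hx, rfl⟩; exact ⟨(x, A), hx, rfl⟩

/-- `fcornerK` computes `fcorner`. [folklore] -/
theorem fcornerK_eq {kt : ℕ} (hL : WF d L = true) (hA : AOK L = true) {w : List ℤ} (hw : w.length = d) :
    fcornerK kt (fKK d L a) w = fcorner kt (toM L : MState d) a (toSite w) := by
  have hWF := WF_fKK hL a
  rw [Bool.eq_iff_iff, fcorner_iff]
  constructor
  · intro h
    unfold fcornerK at h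
    cases hP : posAtK (fKK d L a) kt with
    | none => rw [hP] at h; exact Bool.noConfusion h
    | some P =>
      cases h1 : posAtK (fKK d L a) (kt - 1) with
      | none => rw [hP, h1] at h; exact Bool.noConfusion h
      | some x₁ =>
        cases h2 : posAtK (fKK d L a) (kt - 2) with
        | none => rw [hP, h1, h2] at h; exact Bool.noConfusion h
        | some x₂ =>
          rw [hP, h1, h2] at h
          have hw' := of_decide_eq_true h
          have mP := (posAtK_eq_some_iff hA).1 hP
          have m1 := (posAtK_eq_some_iff hA).1 h1
          have m2 := (posAtK_eq_some_iff hA).1 h2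
          have lP := length_of_WF hWF mP
          have l1' := length_of_WF hWF m1
          have l2 := length_of_WF hWF m2
          refine ⟨toSite P, toSite x₁, toSite x₂, (mem_fK_age_iff hL).2 ⟨P, mP, rfl⟩, (mem_fK_age_iff hL).2 ⟨x₁, m1, rfl⟩,
            (mem_fK_age_iff hL).2 ⟨x₂, m2, rfl⟩, ?_⟩
          rw [hw', toSite_subL (length_addL lP l2) l1', toSite_addL lP l2]
  · rintro ⟨P, x₁, x₂, hP, h1, h2, hwe⟩
    obtain ⟨Pl, mP, rfl⟩ := (mem_fK_age_iff hL).1 hP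
    obtain ⟨x1l, m1, rfl⟩ := (mem_fK_age_iff hL).1 h1
    obtain ⟨x2l, m2, rfl⟩ := (mem_fK_age_iff hL).1 h2
    have lP := length_of_WF hWF mP
    have l1' := length_of_WF hWF m1
    have l2 := length_of_WF hWF m2
    unfold fcornerK
    rw [(posAtK_eq_some_iff hA).2 mP, (posAtK_eq_some_iff hA).2 m1, (posAtK_eq_some_iff hA).2 m2]
    refine decide_eq_true (toSite_inj hw (length_subL (length_addL lP l2) l1') ?_)
    rw [hwe, toSite_subL (length_addL lP l2) l1', toSite_addL lP l2]

/-- `fcondK` computes `fcond`. [folklore] -/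
theorem fcondK_eq {kt : ℕ} (hL : WF d L = true) (hA : AOK L = true) {w : List ℤ} (hw : w.length = d) :
    fcondK kt d (fKK d L a) w = fcond kt (toM L : MState d) a (toSite w) := by
  rw [fcondK, fcond, funcondK_eq hL hw, fcornerK_eq hL hA hw]

/-- The kernel inspected sites have length `d`. [folklore] -/
theorem length_of_mem_fsitesK {kt : ℕ} (hL : WF d L = true) {w : List ℤ} (hw : w ∈ fsitesK kt d (fKK d L a)) :
    w.length = d := by
  unfold fsitesK at hw
  cases hP : posAtK (fKK d L a) kt with
  | none => rw [hP] at hw; simp at hw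
  | some P =>
    rw [hP] at hw
    have hPm : (P, kt) ∈ fKK d L a := by
      rw [posAtK] at hP
      cases hf : (fKK d L a).find? (fun q => q.2 == kt) with
      | none => rw [hf] at hP; exact absurd hP (by simp)
      | some y =>
        have hy := List.find?_some hf
        simp only [beq_iff_eq] at hy
        rw [hf, Option.map_some] at hP
        have := Option.some.inj hP
        rw [← this, ← hy]; exact List.mem_of_find?_eq_some hf
    exact length_of_mem_nbrL (length_of_WF (WF_fKK hL a) hPm) (List.mem_filter.1 hw).1

/-- **The kernel inspected sites denote the inspected sites, without repetition.** [folklore] -/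
theorem fsites_eq_toFinset {kt : ℕ} (hL : WF d L = true) (hA : AOK L = true) :
    fsites kt (toM L : MState d) a = ((fsitesK kt d (fKK d L a)).map (toSite (d := d))).toFinset ∧
      ((fsitesK kt d (fKK d L a)).map (toSite (d := d))).Nodup := by
  have hWF := WF_fKK hL a
  unfold fsitesK
  cases hP : posAtK (fKK d L a) kt with
  | none =>
    refine ⟨?_, by simp⟩
    simp only [List.map_nil, List.toFinset_nil]
    rw [eq_empty_iff_forall_notMem]
    intro w hw
    obtain ⟨P, hPK, -, -⟩ := (mem_fsites kt).1 hw
    obtain ⟨x, hx, -⟩ := (mem_fK_age_iff hL).1 hPK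
    rw [(posAtK_eq_some_iff hA).2 hx] at hP
    simp at hP
  | some P =>
    have mP := (posAtK_eq_some_iff hA).1 hP
    have lP := length_of_WF hWF mP
    obtain ⟨h1, h2⟩ := nbrL_toFinset (d := d) lP
    constructor
    · ext w
      rw [mem_fsites, List.mem_toFinset, List.mem_map]
      constructor
      · rintro ⟨P', hP', hadj, hpos⟩
        obtain ⟨x, hx, rfl⟩ := (mem_fK_age_iff hL).1 hP'
        have hxP : x = P := by
          have := List.inj_on_of_nodup_map (nodup_ages_fKK hA a) hx mP rfl
          exact congrArg Prod.fst this
        subst hxP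
        have hw' : w ∈ ((nbrL d x).map (toSite (d := d))).toFinset := by rw [h1]; exact mem_nbrSites.2 hadj
        obtain ⟨u, hu, rfl⟩ := List.mem_map.1 (List.mem_toFinset.1 hw')
        refine ⟨u, List.mem_filter.2 ⟨hu, ?_⟩, rfl⟩
        simp only [Bool.not_eq_true']
        by_contra h
        rw [Bool.not_eq_false, isPosK_iff hL (length_of_mem_nbrL lP hu)] at h
        exact hpos h
      · rintro ⟨u, hu, rfl⟩
        obtain ⟨hun, hP⟩ := List.mem_filter.1 hu
        have hul := length_of_mem_nbrL lP hun
        have hadj : (zdGraph d).Adj (toSite P) (toSite u) := by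
          rw [← mem_nbrSites, ← h1]; exact List.mem_toFinset.2 (List.mem_map.2 ⟨u, hun, rfl⟩)
        refine ⟨toSite P, (mem_fK_age_iff hL).2 ⟨P, mP, rfl⟩, hadj, fun h => ?_⟩
        rw [← isPosK_iff hL hul] at h
        simp only [Bool.not_eq_true'] at hP
        rw [hP] at h; exact Bool.noConfusion h
    · exact h2.sublist (List.Sublist.map _ List.filter_sublist)

end SiteBridges

end NawK

end Summit.CriticalPhenomena.PercolationContinuityZ3.Theorems.Pcint
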